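import Literature.RepresentationTheory.HeisenbergGroup.DoubledDeltaInvariantFunctional
import Literature.RepresentationTheory.HeisenbergGroup.MetaplecticSumStrippingRight
import Literature.RepresentationTheory.HeisenbergGroup.SchrodingerConjugateGram
import Literature.RepresentationTheory.HeisenbergGroup.SchrodingerIsotropicEigenfunctional
import Literature.NumberTheory.Automorphic.SchwartzBruhatL2Complement
import HarnessLib

/-!
# Diagonal invariance of the Frobenius transform of `f₁ ⊠ conj f₂` for common unitary eigenvectors

Topic `RepresentationTheory/HeisenbergGroup`; namespace `Literature.RepresentationTheory.HeisenbergGroup`.  KERNEL ONLY: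
theorems, no definition, no named fact, no `sorry`.

Setting (that of `DoubledDeltaFrobenius` §Transported / `DoubledDeltaInvariantFunctional` §3): `F` a non-archimedean
local field with `2` invertible, `κ`, `ι` finite with `e : κ ⊕ κ ≃ ι`, a Gram matrix `T₀` with `det T₀` a unit, the
doubled Gram matrix `T = reindex e e (T₀ ⊕ (−T₀))` (`hT`), `ψ` a continuous non-trivial additive character, `μ` a Haar
measure on `F^κ`.  Write `ρ_T = schrodingerSB ⟨·, T ·⟩ ψ` on `𝒮(F^ι)`, `ρ_{T₀}`, `ρ_{−T₀}` for the two blocks,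
`Λ = diagIntegral e μ : Φ ↦ ∫ Φ(u ⊔ u) dμ` and `𝒯 = frobeniusToSchrodinger (ρ_T ∘ Φ_Δ⁻¹) Λ` for the Frobenius transform
to the `ℓ_Δ`-model (`DoubledDeltaFrobenius`: `𝒯 Φ (a ⊔ b) = ∫ ψ(2⟨u, T₀ b⟩) Φ((u + a) ⊔ (u − a)) dμ`).

For `g ∈ Sp(W_{T₀})` the DIAGONAL element `(g ⊕ 1)(1 ⊕ g) = spInl g · spInr g'` of `Sp(W_T)` (`g' = g` read in
`Sp(W_{−T₀})`, same elements: `mem_symplecticGroup_gram_neg_iff`) acts on `W_T = W_{T₀} ⊕ W_{−T₀}` by `g` on both blocks,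
hence preserves the Lagrangians `ℓ_Δ = {(α ⊔ α, β ⊔ β)}` and `ℓ_∇ = {(a ⊔ −a, b ⊔ −b)}`:

* §1 `inlW_mul_inrW_deltaW` / `inlW_mul_inrW_nablaW`: `(g ⊕ 1)(1 ⊕ g) · deltaW α β = deltaW (g(α, β))`, same for
  `nablaW`; `coe_spInl_mul_spInr`; hence Weil's section has NO central correction on them:
  `act_ofSymplectic_deltaW` / `act_ofSymplectic_nablaW` (`act_ofSymplectic_mk_half` with `β_T(w, w) = 0` on `ℓ_Δ`, `ℓ_∇`).
* §2 box implementers: `exists_linearEquiv_map_boxSB` (`M₁ ⊠ M₂` as a linear automorphism of `𝒮(F^ι)`, as in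
  `MetaplecticSumStrippingRight`), and `map_boxSB_conjSB_of_eigen`: if `M (f₁ ⊠ f₂) = M₁ f₁ ⊠ (conj ∘ M₁ ∘ conj) f₂` and
  `M₁ fᵢ = ξ fᵢ` with `|ξ| = 1`, then `M (f₁ ⊠ conj f₂) = f₁ ⊠ conj f₂` (`ξ conj ξ = 1`).
* §3 the diagonal integral: `diagIntegral_boxSB_conjSB` (`Λ(f ⊠ conj h) = ∫ f conj h dμ`),
  `diagIntegral_boxSB_conjSB_self_ne_zero` (`Λ(f ⊠ conj f) = ‖f‖²_{L²} ≠ 0` for `f ≠ 0`, tree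
  `SchwartzBruhat.integral_conj_mul_self`, `l2NormSq_pos`), `diagIntegral_map_schrodingerSB_deltaW` (for `M` implementing
  a diagonal element, `Λ ∘ M` is `ℓ_Δ`-invariant, `Λ` being so: `diagIntegral_schrodingerSB_deltaW`), and
  **`diagIntegral_map_eq`**: such an `M = M₁ ⊠ conjOp M₁` with a unitary eigenvector `f₁ ≠ 0` of `M₁` PRESERVES `Λ` —
  `Λ ∘ M = c Λ` by the uniqueness of `ℓ_Δ`-invariant functionals (`exists_eq_mul_diagIntegral_of_forall_deltaW`, H15) and
  `c = 1` on `f₁ ⊠ conj f₁`.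
* §4 **MAIN `deltaFrobenius_boxSB_conjSB_apply_glue_symplectic`**: for `g ∈ Sp(W_{T₀})`, an implementer `M₁` of `g` on
  `ρ_{T₀}` and `f₁, f₂ ∈ 𝒮(F^κ)` with `M₁ fᵢ = ξ fᵢ`, `|ξ| = 1`, `f₁ ≠ 0`:
  `𝒯(f₁ ⊠ conj f₂)((g(a, b)).1 ⊔ (g(a, b)).2) = 𝒯(f₁ ⊠ conj f₂)(a ⊔ b)` for all `a, b` — with
  `𝒯 Φ (a ⊔ b) = Λ(ρ_T(nablaW a b, 0) Φ)` (`deltaFrobenius_apply_glue_eq_diagIntegral`), `ρ_T(s · h) F = M ρ_T(h) M⁻¹ F`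
  for the box implementer `M = M₁ ⊠ conjOp M₁` of `s = spInl g · spInr g` (`implements_of_boxSB`, H4;
  `implements_conjOp_ofSymplectic_gram'`, H14), `M⁻¹ F = F` (§2) and `Λ ∘ M = Λ` (§3).

Written for the cell `hodgecm-mathlib` (fan B, rung B-IV, KEY `b4-howe-compact-irreducible`, node E9 = helper H17 of the
doubling proof of `MoeglinVignerasWaldspurger1987.mvw_IV4_rankOne_irreducibleOrZero`): for `f₁, f₂` in a `χ`-isotypic
part of the Weil representation restricted to the compact member `U(1) ⊂ Sp(W_{T₀})`, the matrix-coefficient function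
`𝒯(f₁ ⊠ conj f₂)` on `W_{T₀} ≅ ℓ_Δ` is `U(1)`-INVARIANT (the «geometric `E¹`-invariance» of [Howe1979] §11 /
[MoeglinVignerasWaldspurger1987] Chap. 3 for the pair `(U(1), U(V))`).  Nothing about theta lifts is asserted here.

## References
* [MoeglinVignerasWaldspurger1987] C. Mœglin, M.-F. Vignéras, J.-L. Waldspurger, LNM 1291 (1987), Chap. 2 I.7, II.1 (A),
  II.6; Chap. 3 IV.
* [Kudla1994] S. Kudla, Israel J. Math. 87 (1994), §2 (doubled space, diagonal Lagrangian).
* [Weil1964] A. Weil, Acta Math. 111 (1964), n° 5 (the section over `Sp` when `2` is invertible), Chap. I n° 11.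
-/

set_option autoImplicit false

noncomputable section

open _root_.MeasureTheory
open scoped ComplexConjugate

namespace Literature.RepresentationTheory.HeisenbergGroup

open Literature.NumberTheory.Automorphic

/-! ## §1 The diagonal element `(g ⊕ 1)(1 ⊕ g)` on `ℓ_Δ` and `ℓ_∇` -/

section Geometry

variable {K : Type*} [CommRing K] {κ ι : Type*} [Fintype κ] [Fintype ι] [DecidableEq κ] [DecidableEq ι]
  (e : κ ⊕ κ ≃ ι) (T₀ : Matrix κ κ K) {T : Matrix ι ι K}
  (hT : T = Matrix.reindex e e (Matrix.fromBlocks T₀ 0 0 (-T₀)))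

omit [Fintype κ] [Fintype ι] [DecidableEq κ] [DecidableEq ι] in
/-- `(g ⊕ 1)(1 ⊕ g)` maps the diagonal vector `(α ⊔ α, β ⊔ β)` to the diagonal vector of `g(α, β)`. [cite: Kudla1994, §2] -/
theorem inlW_mul_inrW_deltaW (g₀ : ((κ → K) × (κ → K)) ≃ₗ[K] ((κ → K) × (κ → K))) (α β : κ → K) :
    (inlW e g₀ * inrW e g₀) (deltaW e α β) = deltaW e (g₀ (α, β)).1 (g₀ (α, β)).2 := by
  rw [LinearEquiv.mul_apply]
  change inlW e g₀ (inrW e g₀ (glue e α α, glue e β β)) = (glue e _ _, glue e _ _)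
  rw [inrW_apply_glue, inlW_apply_glue]

omit [Fintype κ] [Fintype ι] [DecidableEq κ] [DecidableEq ι] in
/-- `(g ⊕ 1)(1 ⊕ g)` maps the antidiagonal vector `(a ⊔ −a, b ⊔ −b)` to the antidiagonal vector of `g(a, b)`.
[cite: Kudla1994, §2] -/
theorem inlW_mul_inrW_nablaW (g₀ : ((κ → K) × (κ → K)) ≃ₗ[K] ((κ → K) × (κ → K))) (a b : κ → K) :
    (inlW e g₀ * inrW e g₀) (nablaW e a b) = nablaW e (g₀ (a, b)).1 (g₀ (a, b)).2 := by
  rw [LinearEquiv.mul_apply]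
  change inlW e g₀ (inrW e g₀ (glue e a (-a), glue e b (-b))) = (glue e _ (-_), glue e _ (-_))
  rw [inrW_apply_glue, inlW_apply_glue, ← Prod.neg_mk, map_neg, Prod.fst_neg, Prod.snd_neg]

/-- the underlying automorphism of `spInl g · spInr g'` is `(g ⊕ 1)(1 ⊕ g')`. [cite: Kudla1994, §2] -/
theorem coe_spInl_mul_spInr (g : symplecticGroup (polar (Matrix.toLinearMap₂' K T₀)))
    (g' : symplecticGroup (polar (Matrix.toLinearMap₂' K (-T₀)))) :
    ((spInl e T₀ (-T₀) hT g * spInr e T₀ (-T₀) hT g' : symplecticGroup (polar (Matrix.toLinearMap₂' K T))) :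
        ((ι → K) × (ι → K)) ≃ₗ[K] ((ι → K) × (ι → K))) = inlW e g.1 * inrW e g'.1 := by
  rw [Subgroup.coe_mul, coe_spInl, coe_spInr]

variable [Invertible (2 : K)]

include hT in
/-- **Weil's section of a diagonal element on `ℓ_Δ` has no central correction**: if `s ∈ Sp(W_T)` has underlying map
`(g ⊕ 1)(1 ⊕ g)`, then `ofSymplectic s · (deltaW α β, 0) = (deltaW (g(α, β)), 0)` (`β_T` vanishes on `ℓ_Δ × ℓ_Δ`).
[cite: Weil1964, n° 5 (5)–(7), pp. 149–151] -/
theorem act_ofSymplectic_deltaW {s : symplecticGroup (polar (Matrix.toLinearMap₂' K T))}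
    {g₀ : ((κ → K) × (κ → K)) ≃ₗ[K] ((κ → K) × (κ → K))}
    (hs : (s : ((ι → K) × (ι → K)) ≃ₗ[K] ((ι → K) × (ι → K))) = inlW e g₀ * inrW e g₀) (α β : κ → K) :
    (ofSymplectic (polar (Matrix.toLinearMap₂' K T)) s).act ⟨deltaW e α β, 0⟩ =
      ⟨deltaW e (g₀ (α, β)).1 (g₀ (α, β)).2, 0⟩ := by
  have h0 : (⟨deltaW e α β, 0⟩ : Heisenberg (polar (Matrix.toLinearMap₂' K T))) =
      ⟨deltaW e α β, ⅟(2 : K) * polar (Matrix.toLinearMap₂' K T) (deltaW e α β) (deltaW e α β)⟩ := by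
    rw [polar_deltaW_deltaW e T₀ hT, mul_zero]
  have h1 : (s : ((ι → K) × (ι → K)) ≃ₗ[K] ((ι → K) × (ι → K))) (deltaW e α β) =
      deltaW e (g₀ (α, β)).1 (g₀ (α, β)).2 := by
    rw [hs, inlW_mul_inrW_deltaW]
  rw [h0, act_ofSymplectic_mk_half, h1, polar_deltaW_deltaW e T₀ hT, mul_zero]

include hT in
/-- **Weil's section of a diagonal element on `ℓ_∇` has no central correction**: with `s` as above,
`ofSymplectic s · (nablaW a b, 0) = (nablaW (g(a, b)), 0)`. [cite: Weil1964, n° 5 (5)–(7), pp. 149–151] -/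
theorem act_ofSymplectic_nablaW {s : symplecticGroup (polar (Matrix.toLinearMap₂' K T))}
    {g₀ : ((κ → K) × (κ → K)) ≃ₗ[K] ((κ → K) × (κ → K))}
    (hs : (s : ((ι → K) × (ι → K)) ≃ₗ[K] ((ι → K) × (ι → K))) = inlW e g₀ * inrW e g₀) (a b : κ → K) :
    (ofSymplectic (polar (Matrix.toLinearMap₂' K T)) s).act ⟨nablaW e a b, 0⟩ =
      ⟨nablaW e (g₀ (a, b)).1 (g₀ (a, b)).2, 0⟩ := by
  have h0 : (⟨nablaW e a b, 0⟩ : Heisenberg (polar (Matrix.toLinearMap₂' K T))) =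
      ⟨nablaW e a b, ⅟(2 : K) * polar (Matrix.toLinearMap₂' K T) (nablaW e a b) (nablaW e a b)⟩ := by
    rw [polar_nablaW_nablaW e T₀ hT, mul_zero]
  have h1 : (s : ((ι → K) × (ι → K)) ≃ₗ[K] ((ι → K) × (ι → K))) (nablaW e a b) =
      nablaW e (g₀ (a, b)).1 (g₀ (a, b)).2 := by
    rw [hs, inlW_mul_inrW_nablaW]
  rw [h0, act_ofSymplectic_mk_half, h1, polar_nablaW_nablaW e T₀ hT, mul_zero]

end Geometry

/-! ## §2 Box implementers `M₁ ⊠ M₂` and common eigenvectors -/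

section Box

variable {K : Type*} [Field K] [ValuativeRel K] [TopologicalSpace K] [IsNonarchimedeanLocalField K]
  {ι₁ ι₂ ι : Type*} [Fintype ι₁] [Fintype ι₂] [Fintype ι] (e : ι₁ ⊕ ι₂ ≃ ι)

/-- **`M₁ ⊠ M₂` as a linear automorphism of `𝒮(K^ι)`**: for linear automorphisms `M₁`, `M₂` of the factors there is a
linear automorphism `M` of `𝒮(K^ι)` with `M (f₁ ⊠ f₂) = M₁ f₁ ⊠ M₂ f₂` (the tree's `sumEndSB` with inverse
`M₁⁻¹ ⊠ M₂⁻¹`, as in `MetaplecticSumStrippingRight.exists_smul_boxSB_of_implements_mul`).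
[cite: MoeglinVignerasWaldspurger1987, Chap. 2 II.1 Rem. (6)] -/
theorem exists_linearEquiv_map_boxSB (M₁ : SchwartzBruhat (ι₁ → K) ≃ₗ[ℂ] SchwartzBruhat (ι₁ → K))
    (M₂ : SchwartzBruhat (ι₂ → K) ≃ₗ[ℂ] SchwartzBruhat (ι₂ → K)) :
    ∃ M : SchwartzBruhat (ι → K) ≃ₗ[ℂ] SchwartzBruhat (ι → K),
      ∀ (f₁ : SchwartzBruhat (ι₁ → K)) (f₂ : SchwartzBruhat (ι₂ → K)),
        M (boxSB K e f₁ f₂) = boxSB K e (M₁ f₁) (M₂ f₂) := by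
  have h1 : sumEndSB K e (M₁ : SchwartzBruhat (ι₁ → K) →ₗ[ℂ] SchwartzBruhat (ι₁ → K))
        (M₂ : SchwartzBruhat (ι₂ → K) →ₗ[ℂ] SchwartzBruhat (ι₂ → K)) ∘ₗ
      sumEndSB K e (M₁.symm : SchwartzBruhat (ι₁ → K) →ₗ[ℂ] SchwartzBruhat (ι₁ → K))
        (M₂.symm : SchwartzBruhat (ι₂ → K) →ₗ[ℂ] SchwartzBruhat (ι₂ → K)) = LinearMap.id := by
    rw [← sumEndSB_comp, ← sumEndSB_id K e]
    congr 1 <;> exact LinearMap.ext fun x => by simp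
  have h2 : sumEndSB K e (M₁.symm : SchwartzBruhat (ι₁ → K) →ₗ[ℂ] SchwartzBruhat (ι₁ → K))
        (M₂.symm : SchwartzBruhat (ι₂ → K) →ₗ[ℂ] SchwartzBruhat (ι₂ → K)) ∘ₗ
      sumEndSB K e (M₁ : SchwartzBruhat (ι₁ → K) →ₗ[ℂ] SchwartzBruhat (ι₁ → K))
        (M₂ : SchwartzBruhat (ι₂ → K) →ₗ[ℂ] SchwartzBruhat (ι₂ → K)) = LinearMap.id := by
    rw [← sumEndSB_comp, ← sumEndSB_id K e]
    congr 1 <;> exact LinearMap.ext fun x => by simp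
  exact ⟨LinearEquiv.ofLinear _ _ h1 h2, fun f₁ f₂ => sumEndSB_boxSB K e _ _ f₁ f₂⟩

end Box

/-! ## §3 The diagonal integral under box implementers of diagonal elements -/

section Doubled

variable {F : Type*} [Field F] [ValuativeRel F] [TopologicalSpace F] [IsNonarchimedeanLocalField F]
  {κ ι : Type*} [Fintype κ] [Fintype ι] [DecidableEq κ] [DecidableEq ι]
  (e : κ ⊕ κ ≃ ι) (T₀ : Matrix κ κ F) {T : Matrix ι ι F}
  (hT : T = Matrix.reindex e e (Matrix.fromBlocks T₀ 0 0 (-T₀)))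
  {ψ : AddChar F Circle} (hl : IsLocallyConstant (⇑ψ : F → Circle))
  (hb : ∀ y : ι → F, Continuous fun u : ι → F => Matrix.toLinearMap₂' F T u y)
  (hb₀ : ∀ y : κ → F, Continuous fun u : κ → F => Matrix.toLinearMap₂' F T₀ u y)
  [MeasurableSpace (κ → F)] [BorelSpace (κ → F)] (μ : Measure (κ → F))

omit [DecidableEq κ] [DecidableEq ι] [MeasurableSpace (κ → F)] [BorelSpace (κ → F)] in
/-- **common unitary eigenvectors**: if `M (f₁ ⊠ f₂) = M₁ f₁ ⊠ (conj ∘ M₁ ∘ conj) f₂` for all `f₁, f₂` and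
`M₁ f₁ = ξ f₁`, `M₁ f₂ = ξ f₂` with `|ξ| = 1`, then `M (f₁ ⊠ conj f₂) = f₁ ⊠ conj f₂` (the eigenvalue of the product is
`ξ · conj ξ = 1`). [cite: MoeglinVignerasWaldspurger1987, Chap. 2 II.1 (A)] -/
theorem map_boxSB_conjSB_of_eigen {M₁ : SchwartzBruhat (κ → F) ≃ₗ[ℂ] SchwartzBruhat (κ → F)}
    {M : SchwartzBruhat (ι → F) ≃ₗ[ℂ] SchwartzBruhat (ι → F)}
    (hM : ∀ (f₁ : SchwartzBruhat (κ → F)) (f₂ : SchwartzBruhat (κ → F)),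
      M (boxSB F e f₁ f₂) = boxSB F e (M₁ f₁) (conjOp M₁ f₂))
    {ξ : ℂ} (hξ : ‖ξ‖ = 1) {f₁ f₂ : SchwartzBruhat (κ → F)} (h₁ : M₁ f₁ = ξ • f₁) (h₂ : M₁ f₂ = ξ • f₂) :
    M (boxSB F e f₁ (conjSB f₂)) = boxSB F e f₁ (conjSB f₂) := by
  rw [hM, conjOp_apply, conjSB_conjSB, h₁, h₂, conjSB_smul, boxSB_smul_left, boxSB_smul_right, smul_smul,
    Complex.mul_conj', hξ, Complex.ofReal_one, one_pow, one_smul]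


omit [DecidableEq κ] [DecidableEq ι] in
/-- `Λ(f ⊠ conj h) = ∫ f(u) conj(h(u)) dμ(u)`. [cite: MoeglinVignerasWaldspurger1987, Chap. 2 I.7] -/
theorem diagIntegral_boxSB_conjSB [IsFiniteMeasureOnCompacts μ] (f h : SchwartzBruhat (κ → F)) :
    diagIntegral e μ (boxSB F e f (conjSB h)) =
      ∫ u, (f : (κ → F) → ℂ) u * conj ((h : (κ → F) → ℂ) u) ∂μ := by
  rw [diagIntegral_apply]
  simp only [boxSB_apply_glue, coe_conjSB_apply]

omit [DecidableEq κ] [DecidableEq ι] in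
/-- `Λ(f ⊠ conj f) = ‖f‖²_{L²(μ)} ≠ 0` for `f ≠ 0` (`μ` positive on non-empty open sets and finite on compact sets).
[cite: Weil1964, Chap. I n° 11] -/
theorem diagIntegral_boxSB_conjSB_self_ne_zero [IsFiniteMeasureOnCompacts μ] [μ.IsOpenPosMeasure]
    {f : SchwartzBruhat (κ → F)} (hf : f ≠ 0) : diagIntegral e μ (boxSB F e f (conjSB f)) ≠ 0 := by
  rw [diagIntegral_boxSB_conjSB]
  simp_rw [mul_comm ((f : (κ → F) → ℂ) _) _]
  rw [SchwartzBruhat.integral_conj_mul_self μ f, Ne, Complex.ofReal_eq_zero]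
  exact (ENNReal.toReal_pos (SchwartzBruhat.l2NormSq_pos μ hf).ne' (SchwartzBruhat.l2NormSq_ne_top μ f)).ne'

variable [Invertible (2 : F)]

include hT in
/-- **`Λ ∘ M` is `ℓ_Δ`-invariant** when `M` implements (for `ρ_T`) Weil's section of a diagonal element
`(g ⊕ 1)(1 ⊕ g)`: `Λ(M(ρ_T(deltaW α β, 0) Φ)) = Λ(M Φ)` (the element maps `(deltaW α β, 0)` to `(deltaW (g(α,β)), 0)`
and `Λ` is `ℓ_Δ`-invariant, `diagIntegral_schrodingerSB_deltaW`). [cite: MoeglinVignerasWaldspurger1987, Chap. 2 II.6] -/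
theorem diagIntegral_map_schrodingerSB_deltaW [μ.IsAddHaarMeasure]
    {s : symplecticGroup (polar (Matrix.toLinearMap₂' F T))} {g₀ : ((κ → F) × (κ → F)) ≃ₗ[F] ((κ → F) × (κ → F))}
    (hs : (s : ((ι → F) × (ι → F)) ≃ₗ[F] ((ι → F) × (ι → F))) = inlW e g₀ * inrW e g₀)
    {M : SchwartzBruhat (ι → F) ≃ₗ[ℂ] SchwartzBruhat (ι → F)}
    (hM : Implements (schrodingerSB (Matrix.toLinearMap₂' F T) ψ hl hb) (ofSymplectic _ s) M) (α β : κ → F)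
    (Φ : SchwartzBruhat (ι → F)) :
    diagIntegral e μ (M (schrodingerSB (Matrix.toLinearMap₂' F T) ψ hl hb ⟨deltaW e α β, 0⟩ Φ)) =
      diagIntegral e μ (M Φ) := by
  rw [hM, act_ofSymplectic_deltaW e T₀ hT hs, diagIntegral_schrodingerSB_deltaW e T₀ hT hl hb μ]

include hT in
/-- **a box implementer of a diagonal element with a unitary eigenvector preserves the diagonal integral.**  Let
`s ∈ Sp(W_T)` have underlying map `(g ⊕ 1)(1 ⊕ g)`, let `M` implement `ofSymplectic s` for `ρ_T` and satisfy
`M (f₁ ⊠ f₂) = M₁ f₁ ⊠ (conj ∘ M₁ ∘ conj) f₂`, and let `M₁ f₁ = ξ f₁` with `|ξ| = 1`, `f₁ ≠ 0`.  Then `Λ(M Φ) = Λ(Φ)` for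
all `Φ`: `Λ ∘ M` is `ℓ_Δ`-invariant, hence `= c · Λ` (`exists_eq_mul_diagIntegral_of_forall_deltaW`; `det T₀` a unit, `ψ`
continuous non-trivial, `μ` Haar), and `c = 1` by evaluating at `f₁ ⊠ conj f₁`, fixed by `M` and with `Λ ≠ 0`.
[cite: MoeglinVignerasWaldspurger1987, Chap. 2 II.6] -/
theorem diagIntegral_map_eq [μ.IsAddHaarMeasure] (hψ : ψ.IsContinuousNontrivial) (hT₀ : IsUnit T₀.det)
    {s : symplecticGroup (polar (Matrix.toLinearMap₂' F T))} {g₀ : ((κ → F) × (κ → F)) ≃ₗ[F] ((κ → F) × (κ → F))}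
    (hs : (s : ((ι → F) × (ι → F)) ≃ₗ[F] ((ι → F) × (ι → F))) = inlW e g₀ * inrW e g₀)
    {M : SchwartzBruhat (ι → F) ≃ₗ[ℂ] SchwartzBruhat (ι → F)}
    (hM : Implements (schrodingerSB (Matrix.toLinearMap₂' F T) ψ hl hb) (ofSymplectic _ s) M)
    {M₁ : SchwartzBruhat (κ → F) ≃ₗ[ℂ] SchwartzBruhat (κ → F)}
    (hMb : ∀ (f₁ : SchwartzBruhat (κ → F)) (f₂ : SchwartzBruhat (κ → F)),
      M (boxSB F e f₁ f₂) = boxSB F e (M₁ f₁) (conjOp M₁ f₂))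
    {ξ : ℂ} (hξ : ‖ξ‖ = 1) {f₁ : SchwartzBruhat (κ → F)} (h₁ : M₁ f₁ = ξ • f₁) (hf₁ : f₁ ≠ 0)
    (Φ : SchwartzBruhat (ι → F)) : diagIntegral e μ (M Φ) = diagIntegral e μ Φ := by
  obtain ⟨c, hc⟩ := exists_eq_mul_diagIntegral_of_forall_deltaW e T₀ hT hl hb μ hψ hT₀
    (diagIntegral e μ ∘ₗ (M : SchwartzBruhat (ι → F) →ₗ[ℂ] SchwartzBruhat (ι → F))) fun α β Φ => by
      rw [LinearMap.comp_apply, LinearMap.comp_apply, LinearEquiv.coe_coe]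
      exact diagIntegral_map_schrodingerSB_deltaW e T₀ hT hl hb μ hs hM α β Φ
  simp only [LinearMap.comp_apply, LinearEquiv.coe_coe] at hc
  have hF₀ := hc (boxSB F e f₁ (conjSB f₁))
  rw [map_boxSB_conjSB_of_eigen e hMb hξ h₁ h₁] at hF₀
  have hc1 : c = 1 :=
    (mul_right_cancel₀ (diagIntegral_boxSB_conjSB_self_ne_zero e μ hf₁) ((one_mul _).trans hF₀).symm)
  rw [hc Φ, hc1, one_mul]

/-! ## §4 Diagonal invariance of `𝒯(f₁ ⊠ conj f₂)` -/

include hT in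
/-- the Frobenius transform at a glued point is the diagonal integral of an `ℓ_∇`-translate:
`𝒯 Φ (a ⊔ b) = Λ(ρ_T(nablaW a b, 0) Φ)` (`Φ_Δ⁻¹((a ⊔ b, 0), 0) = (nablaW a b, 0)`).
[cite: MoeglinVignerasWaldspurger1987, Chap. 2 I.7] -/
theorem deltaFrobenius_apply_glue_eq_diagIntegral [IsFiniteMeasureOnCompacts μ] (a b : κ → F)
    (Φ : SchwartzBruhat (ι → F)) :
    frobeniusToSchrodinger ((schrodingerSB (Matrix.toLinearMap₂' F T) ψ hl hb).comp
        (deltaHeisenbergEquiv e T₀ hT).symm.toMonoidHom : Representation ℂ _ (SchwartzBruhat (ι → F))) (diagIntegral e μ) Φ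
        (glue e a b) =
      diagIntegral e μ (schrodingerSB (Matrix.toLinearMap₂' F T) ψ hl hb ⟨nablaW e a b, 0⟩ Φ) := by
  rw [frobeniusToSchrodinger_apply, MonoidHom.comp_apply, MulEquiv.coe_toMonoidHom,
    deltaHeisenbergEquiv_symm_inX e T₀ hT, resL_glue, resR_glue]

include hT hb₀ in
/-- **MAIN — diagonal invariance.**  Let `g ∈ Sp(W_{T₀})`, let `M₁` implement Weil's section `ofSymplectic g` on the
Schrödinger model `ρ_{T₀}` of the first block, and let `f₁, f₂ ∈ 𝒮(F^κ)` be eigenvectors of `M₁` with the same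
eigenvalue `ξ` of absolute value `1`, `f₁ ≠ 0`.  Then the Frobenius transform `𝒯(f₁ ⊠ conj f₂)` (to the `ℓ_Δ`-model) is
invariant under `g` acting on the glued coordinates:
`𝒯(f₁ ⊠ conj f₂)((g(a,b)).1 ⊔ (g(a,b)).2) = 𝒯(f₁ ⊠ conj f₂)(a ⊔ b)`.  Proof: `𝒯 F (a ⊔ b) = Λ(ρ_T(nablaW a b, 0) F)`;
the diagonal element `s = spInl g · spInr g` maps `(nablaW a b, 0)` to `(nablaW (g(a,b)), 0)` (§1); its box implementer
`M = M₁ ⊠ conjOp M₁` (H4 `implements_of_boxSB`, H14 `implements_conjOp_ofSymplectic_gram'`) gives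
`ρ_T(s · h) F = M(ρ_T(h) F)` since `M F = F` (§2), and `Λ ∘ M = Λ` (§3).
[cite: MoeglinVignerasWaldspurger1987, Chap. 3 IV (pair `(U(1), U(V))`); Chap. 2 II.6] -/
theorem deltaFrobenius_boxSB_conjSB_apply_glue_symplectic [μ.IsAddHaarMeasure] (hψ : ψ.IsContinuousNontrivial)
    (hT₀ : IsUnit T₀.det) (g : symplecticGroup (polar (Matrix.toLinearMap₂' F T₀)))
    {M₁ : SchwartzBruhat (κ → F) ≃ₗ[ℂ] SchwartzBruhat (κ → F)}
    (hM₁ : Implements (schrodingerSB (Matrix.toLinearMap₂' F T₀) ψ hl hb₀) (ofSymplectic _ g) M₁)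
    {f₁ f₂ : SchwartzBruhat (κ → F)} {ξ : ℂ} (hξ : ‖ξ‖ = 1) (h₁ : M₁ f₁ = ξ • f₁) (h₂ : M₁ f₂ = ξ • f₂)
    (hf₁ : f₁ ≠ 0) (a b : κ → F) :
    frobeniusToSchrodinger ((schrodingerSB (Matrix.toLinearMap₂' F T) ψ hl hb).comp
        (deltaHeisenbergEquiv e T₀ hT).symm.toMonoidHom : Representation ℂ _ (SchwartzBruhat (ι → F))) (diagIntegral e μ)
        (boxSB F e f₁ (conjSB f₂)) (glue e (g.1 (a, b)).1 (g.1 (a, b)).2) =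
      frobeniusToSchrodinger ((schrodingerSB (Matrix.toLinearMap₂' F T) ψ hl hb).comp
        (deltaHeisenbergEquiv e T₀ hT).symm.toMonoidHom : Representation ℂ _ (SchwartzBruhat (ι → F))) (diagIntegral e μ)
        (boxSB F e f₁ (conjSB f₂)) (glue e a b) := by
  -- the second block: `g` read in `Sp(W_{-T₀})`, implemented on `ρ_{-T₀}` by `conj ∘ M₁ ∘ conj`
  have hb₀' : ∀ y : κ → F, Continuous fun u : κ → F => Matrix.toLinearMap₂' F (-T₀) u y := fun y =>
    continuous_toLinearMap₂'_neg_left hb₀ y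
  have hM₂ := implements_conjOp_ofSymplectic_gram' hl hb₀ hb₀' hM₁
  -- the box implementer `M = M₁ ⊠ conjOp M₁` of the diagonal element `s = spInl g · spInr g`
  obtain ⟨M, hM⟩ := exists_linearEquiv_map_boxSB (K := F) e M₁ (conjOp M₁)
  have hImp := implements_of_boxSB e T₀ (-T₀) hT hl hb₀ hb₀' hb g _ hM₁ hM₂ hM
  have hs : ((spInl e T₀ (-T₀) hT g *
      spInr e T₀ (-T₀) hT ⟨g.1, (mem_symplecticGroup_gram_neg_iff T₀ g.1).2 g.2⟩ :
        symplecticGroup (polar (Matrix.toLinearMap₂' F T))) : ((ι → F) × (ι → F)) ≃ₗ[F] ((ι → F) × (ι → F))) =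
      inlW e g.1 * inrW e g.1 :=
    coe_spInl_mul_spInr e T₀ hT g _
  have hMF : M (boxSB F e f₁ (conjSB f₂)) = boxSB F e f₁ (conjSB f₂) := map_boxSB_conjSB_of_eigen e hM hξ h₁ h₂
  -- `𝒯 F (x) = Λ(ρ_T(nablaW x, 0) F)` on both sides, and `(nablaW (g x), 0) = s · (nablaW x, 0)`
  rw [deltaFrobenius_apply_glue_eq_diagIntegral, deltaFrobenius_apply_glue_eq_diagIntegral,
    ← act_ofSymplectic_nablaW e T₀ hT hs a b]
  -- `ρ_T(s · h) F = M (ρ_T(h) F)` and `Λ ∘ M = Λ`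
  have key := hImp ⟨nablaW e a b, 0⟩ (boxSB F e f₁ (conjSB f₂))
  rw [hMF] at key
  rw [← key]
  exact diagIntegral_map_eq e T₀ hT hl hb μ hψ hT₀ hs hImp hM hξ h₁ hf₁ _

end Doubled

end Literature.RepresentationTheory.HeisenbergGroup

end
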